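import Literature.Computability.QuantumComplexity.OracleClassicalProgs
import Literature.Computability.QuantumComplexity.RevArith
import Literature.Computability.QuantumComplexity.RevUncompute
import HarnessLib

/-!
# Period finding by eigenvalue estimation of shifts, VII: the classical block (structured wires)

Family `PQC` / quantum-advantage barrier `PPolyOracles`; seventh file towards the discharge of
`Literature.Barriers.QuantumAdvantage.aaronsonChen2017_lem75_quantum` (Aaronson–Chen 2017,
Lemma 7.5 (2)–(3), App. 13). The classical block `V` of the shift experiment
(`PeriodFindingCircuit.sandwich`): for every unit `u` (block length `L_u`) it computes the shifted
offset `X_u = Z_u − A_u(y) (mod 2^{L_u})` of the controls of the unit, queries the oracle on the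
strings `pre_j ++ bits(X_u)`, `j < L_u` (constant prefixes `pre_j`; in the application the
headers `1ⁿ 0 1ʲ 0` of the level-`n` table of `acLang`, `PPolyOraclesThm76.lean`), and uncomputes
`X_u` — a compute / query / uncompute block in the sense of Bennett (Nielsen–Chuang §3.2.5) with
oracle gates in the middle (Bernstein–Vazirani 1997, §8.3).

The block is written over a STRUCTURED wire type `BW S` (controls, offset bits, prefix
constants, and per unit and step: fan-out register `d`, sum register `s`, carries `c`, answer
register `y`), as a program of `NOT`/`CNOT`/Toffoli operations (`ClOp`, `RevGadgets.lean`) and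
oracle queries (`RtOp`, `RazTalBlocks.lean`); the transport to the wires of the circuit
(injective re-indexing, `OSim.ocEval_map_comp`) is in the sequel. Semantics is by the tree's
program algebra: the out-of-place ripple-carry adder `addOps` (`RevArith.lean`,
Vedral–Barenco–Ekert 1996 §3.1) placed by `ClOp.map`, frames (`clEval_ite`), running backwards
(`clEval_reverse_clEval`), queries on basis states (`OSim.ocEval`).

* `BSpec` (units, block lengths `L u ≤ Ltop`, `K` steps with levels `lvl`, prefixes `cpre`);
  wires `BW S`; the program: `preNots`, `fanout`, `adder`, `stepOps`, `steps`, `wOps`, `qry`,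
  `qOps`, `blockOps = wOps; qOps; wOps⁻¹`; well-formedness (`wOps_wf`, `blockOps_wf'`);
* semantics: `w₀` (controls `y`, offsets `Z`, all else `0`), `zval`, `dval`, `acc`, `xval`
  (`= (Z_u + ∑_s dval) mod 2^{L_u}`), `xbits`, `ans`, `wFin`; the step lemma `clEval_stepOps`,
  the accumulation `wOps_acc`, the queries `ocEval_qOps`, and **`ocEval_blockOps`**:
  `ocEval A blockOps w₀ = wFin` — controls and offsets unchanged, answer bit `(u, j)` equal to
  `[cpre j ++ bits(X_u) ∈ A]`, every other wire back to `0`.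

## References

* C. H. Bennett, *Logical reversibility of computation*, IBM J. Res. Dev. 17 (1973), §2; M. A.
  Nielsen, I. L. Chuang, *Quantum Computation and Quantum Information*, CUP 2010, §3.2.5
  (compute–copy/query–uncompute) [NielsenChuang2010].
* V. Vedral, A. Barenco, A. Ekert, Phys. Rev. A 54 (1996), §3.1 (ripple-carry adder)
  [VedralBarencoEkert1996].
* E. Bernstein, U. Vazirani, SIAM J. Comput. 26 (1997), §8.3 (queries on basis states)
  [BernsteinVazirani1997SICOMP].
* A. Yu. Kitaev, arXiv:quant-ph/9511026 (1995), §3 Lemma 10 (the controlled powers `U^{2^l}`,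
  here shifts by `2^l`) [Kitaev1995].
-/

namespace Literature.Computability.Cryptography

namespace PeriodFinding

open QuantumComplexity QuantumComplexity.RazTalMachine QuantumComplexity.RevSim QuantumComplexity.OSim
  Finset Function

/-! ### Parameters and wires -/

/-- **Parameters of the classical block**: `nU` units with block lengths `L u ≤ Ltop`, `K > 0`
steps per unit (one per control), the level `lvl s` of step `s` (its control tests the shift by
`2^{lvl s}`), the width `plen` of the prefix blocks and the constant prefix `cpre j` of the `j`-th
query. [cite: Kitaev1995, §3 Lemma 10] -/
structure BSpec where
  /-- number of units -/
  nU : ℕ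
  /-- block length of unit `u` -/
  L : Fin nU → ℕ
  /-- steps (controls) per unit -/
  K : ℕ
  /-- there is a step -/
  hK : 0 < K
  /-- level of step `s` -/
  lvl : Fin K → ℕ
  /-- register width -/
  Ltop : ℕ
  /-- block lengths fit in the registers -/
  hL : ∀ u, L u ≤ Ltop
  /-- prefix block width -/
  plen : ℕ
  /-- constant prefix of query `j` -/
  cpre : ℕ → List Bool
  /-- prefixes fit in the prefix blocks -/
  hcpre : ∀ j, (cpre j).length ≤ plen

/-- **The wires of the block**: control of step `s` of unit `u`; offset bit `i` of unit `u`;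
position `p` of prefix block `j`; bit `i` of the fan-out register, of the sum register, carry `i`
of step `s` of unit `u`; answer bit `i` of unit `u`. [folklore] -/
inductive BW (S : BSpec) : Type
  | ctrl (u : Fin S.nU) (s : Fin S.K)
  | zbit (u : Fin S.nU) (i : Fin S.Ltop)
  | pre (j : Fin S.Ltop) (p : Fin S.plen)
  | dreg (u : Fin S.nU) (s : Fin S.K) (i : Fin S.Ltop)
  | sreg (u : Fin S.nU) (s : Fin S.K) (i : Fin S.Ltop)
  | creg (u : Fin S.nU) (s : Fin S.K) (i : Fin (S.Ltop + 1))
  | yreg (u : Fin S.nU) (i : Fin S.Ltop)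
  deriving DecidableEq

variable (S : BSpec)

/-- A bit index of unit `u` as a register position. [folklore] -/
abbrev up {u : Fin S.nU} (i : Fin (S.L u)) : Fin S.Ltop := Fin.castLE (S.hL u) i

/-- A carry index of unit `u` as a carry-register position. [folklore] -/
abbrev upc {u : Fin S.nU} (i : Fin (S.L u + 1)) : Fin (S.Ltop + 1) :=
  Fin.castLE (Nat.succ_le_succ (S.hL u)) i

/-- A query index of unit `u` as a prefix-block index. [folklore] -/
abbrev upj {u : Fin S.nU} (j : Fin (S.L u)) : Fin S.Ltop := Fin.castLE (S.hL u) j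

/-- The last step. [folklore] -/
def lastStep : Fin S.K := ⟨S.K - 1, by have := S.hK; omega⟩

/-- The accumulator read by step `s` of unit `u`: the offset register for the first step, the sum
register of the previous step otherwise. [folklore] -/
def accW (u : Fin S.nU) (s : Fin S.K) (i : Fin S.Ltop) : BW S :=
  if h : (s : ℕ) = 0 then BW.zbit u i else BW.sreg u ⟨s - 1, by omega⟩ i

/-- The placement of the adder of step `s` of unit `u`. [cite: VedralBarencoEkert1996, §3.1] -/
def emb (u : Fin S.nU) (s : Fin S.K) : AddW (S.L u) → BW S
  | .a i => accW S u s (up S i)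
  | .b i => BW.dreg u s (up S i)
  | .s i => BW.sreg u s (up S i)
  | .c i => BW.creg u s (upc S i)

/-! ### The program -/

/-- The prefix positions to set to `1`. [folklore] -/
def preOnes : List (BW S) :=
  (List.finRange S.Ltop).flatMap fun j : Fin S.Ltop =>
    ((List.finRange S.plen).filter fun p : Fin S.plen => (S.cpre (j : ℕ)).getD (p : ℕ) false = true).map
      fun p => BW.pre j p

/-- Writing the constant prefixes. [folklore] -/
def preNots : List (ClOp (BW S)) := (preOnes S).map ClOp.not

/-- **Fan-out of step `s`**: `d := y_s · (2^L − 2^{lvl s})`, i.e. copy the control onto the bits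
`lvl s ≤ i < L`: the (control, target) pairs. [cite: Kitaev1995, §3 Lemma 10] -/
def fanPairs (u : Fin S.nU) (s : Fin S.K) : List (BW S × BW S) :=
  ((List.finRange (S.L u)).filter fun i : Fin (S.L u) => S.lvl s ≤ (i : ℕ)).map fun i =>
    (BW.ctrl u s, BW.dreg u s (up S i))

/-- The fan-out as a `CNOT` layer (`copyOps`), empty if `lvl s ≥ L`. [cite: Kitaev1995, §3 Lemma 10] -/
def fanout (u : Fin S.nU) (s : Fin S.K) : List (ClOp (BW S)) :=
  if S.lvl s < S.L u then copyOps (fanPairs S u s) else []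

/-- **The adder of step `s`**: `sreg := acc + d (mod 2^L)`, carries into `creg`. [cite: VedralBarencoEkert1996, §3.1] -/
def adder (u : Fin S.nU) (s : Fin S.K) : List (ClOp (BW S)) := (addOps (S.L u)).map (ClOp.map (emb S u s))

/-- The operations of one step. [folklore] -/
def stepOps (p : Fin S.nU × Fin S.K) : List (ClOp (BW S)) := fanout S p.1 p.2 ++ adder S p.1 p.2

/-- The steps in execution order: unit by unit, step by step (step number `m` is
`(m / K, m % K)`). [folklore] -/
def steps : List (Fin S.nU × Fin S.K) := (List.finRange (S.nU * S.K)).map finProdFinEquiv.symm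

/-- **The compute part**: prefixes, then all steps. [folklore] -/
def wOps : List (ClOp (BW S)) := preNots S ++ (steps S).flatMap (stepOps S)

/-- The wires presenting the prefix of query `j`. [folklore] -/
def preWires (j : Fin S.Ltop) : List (BW S) :=
  (List.finRange (S.cpre j).length).map fun p => BW.pre j (Fin.castLE (S.hcpre j) p)

/-- The wires presenting `X_u` (the sum register of the last step, low `L u` bits). [folklore] -/
def xWires (u : Fin S.nU) : List (BW S) := (List.finRange (S.L u)).map fun i => BW.sreg u (lastStep S) (up S i)

/-- The query indices `(u, j)`, `j < L u`. [folklore] -/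
def qIdx : List (Σ u : Fin S.nU, Fin (S.L u)) :=
  (List.finRange S.nU).flatMap fun u => (List.finRange (S.L u)).map fun j => ⟨u, j⟩

/-- The query wires of query `(u, j)`: prefix `j`, then `X_u`. [folklore] -/
def qWires (a : Σ u : Fin S.nU, Fin (S.L u)) : List (BW S) := preWires S (upj S a.2) ++ xWires S a.1

/-- The answer wire of query `(u, j)`. [folklore] -/
def qTgt (a : Σ u : Fin S.nU, Fin (S.L u)) : BW S := BW.yreg a.1 (up S a.2)

/-- **The queries.** [cite: BernsteinVazirani1997SICOMP, §8.3] -/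
def qOps : List (RtOp (BW S)) := (qIdx S).map fun a => RtOp.oracle (qWires S a) (qTgt S a)

/-- **The block**: compute, query, uncompute. [cite: NielsenChuang2010, §3.2.5] -/
def blockOps : List (RtOp (BW S)) :=
  (wOps S).map RtOp.cl ++ qOps S ++ (wOps S).reverse.map RtOp.cl

/-! ### Well-formedness -/

variable {S}

/-- `accW` never meets the registers written by the same step. [folklore] -/
theorem accW_ne_dreg (u : Fin S.nU) (s : Fin S.K) (i i' : Fin S.Ltop) : accW S u s i ≠ BW.dreg u s i' := by
  unfold accW; split_ifs <;> simp

/-- `accW` never meets the sum register of the same step. [folklore] -/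
theorem accW_ne_sreg (u : Fin S.nU) (s : Fin S.K) (i i' : Fin S.Ltop) : accW S u s i ≠ BW.sreg u s i' := by
  unfold accW
  split_ifs with h
  · simp
  · simp only [ne_eq, BW.sreg.injEq, true_and, not_and]
    intro e
    exact absurd (congrArg Fin.val e) (by simp; omega)

/-- `accW` never meets a carry register. [folklore] -/
theorem accW_ne_creg (u : Fin S.nU) (s : Fin S.K) (i : Fin S.Ltop) (i' : Fin (S.Ltop + 1)) :
    accW S u s i ≠ BW.creg u s i' := by
  unfold accW; split_ifs <;> simp

/-- `accW` is injective in the position. [folklore] -/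
theorem accW_injective (u : Fin S.nU) (s : Fin S.K) : Injective (accW S u s) := by
  intro i i' h
  unfold accW at h
  split_ifs at h <;> simpa using h

/-- **The placement of the adder is injective.** [folklore] -/
theorem emb_injective (u : Fin S.nU) (s : Fin S.K) : Injective (emb S u s) := by
  intro v v' h
  cases v with
  | a i => cases v' with
    | a i' => exact congrArg AddW.a (Fin.castLE_injective _ (accW_injective u s h))
    | b i' => exact absurd h (accW_ne_dreg u s _ _)
    | s i' => exact absurd h (accW_ne_sreg u s _ _)
    | c i' => exact absurd h (accW_ne_creg u s _ _)
  | b i => cases v' with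
    | a i' => exact absurd h.symm (accW_ne_dreg u s _ _)
    | b i' => exact congrArg AddW.b (by simpa [emb] using h)
    | s i' => simp [emb] at h
    | c i' => simp [emb] at h
  | s i => cases v' with
    | a i' => exact absurd h.symm (accW_ne_sreg u s _ _)
    | b i' => simp [emb] at h
    | s i' => exact congrArg AddW.s (by simpa [emb] using h)
    | c i' => simp [emb] at h
  | c i => cases v' with
    | a i' => exact absurd h.symm (accW_ne_creg u s _ _)
    | b i' => simp [emb] at h
    | s i' => simp [emb] at h
    | c i' => exact congrArg AddW.c (by simpa [emb] using h)

/-- Every operation of a step is well formed. [folklore] -/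
theorem stepOps_wf (p : Fin S.nU × Fin S.K) : ∀ op ∈ stepOps S p, op.WF := by
  intro op hop
  rw [stepOps, List.mem_append] at hop
  rcases hop with hop | hop
  · unfold fanout at hop
    split_ifs at hop
    · exact copyOps_wf (fun q hq => by
        obtain ⟨i, -, rfl⟩ := List.mem_map.1 hq
        simp) op hop
    · simp at hop
  · obtain ⟨op', hop', rfl⟩ := List.mem_map.1 hop
    exact (addOps_wf op' hop').map (emb_injective p.1 p.2)

/-- **Every operation of the compute part is well formed.** [folklore] -/
theorem wOps_wf : ∀ op ∈ wOps S, op.WF := by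
  intro op hop
  rw [wOps, List.mem_append] at hop
  rcases hop with hop | hop
  · obtain ⟨a, -, rfl⟩ := List.mem_map.1 hop
    trivial
  · obtain ⟨p, -, hp⟩ := List.mem_flatMap.1 hop
    exact stepOps_wf p op hp

/-! ### Semantics: the data -/

variable (S)

/-- **The initial assignment**: controls `y`, offsets `Z`, everything else `0`. [folklore] -/
def w₀ (y : Fin S.nU → Fin S.K → Bool) (Z : Fin S.nU → Fin S.Ltop → Bool) : BW S → Bool
  | .ctrl u s => y u s
  | .zbit u i => Z u i
  | _ => false

variable (y : Fin S.nU → Fin S.K → Bool) (Z : Fin S.nU → Fin S.Ltop → Bool)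

/-- The value of the offset of unit `u` (low `L u` bits, little-endian). [folklore] -/
def zval (u : Fin S.nU) : ℕ := regVal (fun i : Fin (S.L u) => BW.zbit u (up S i)) (w₀ S y Z)

/-- The addend of step `s`: `y_s · (2^L − 2^{lvl s})` (`≡ −y_s 2^{lvl s} (mod 2^L)`). [cite: Kitaev1995, §3 Lemma 10] -/
def dval (u : Fin S.nU) (s : Fin S.K) : ℕ :=
  if S.lvl s < S.L u ∧ y u s = true then 2 ^ S.L u - 2 ^ S.lvl s else 0

/-- The accumulator after `s` steps: `(Z_u + ∑_{s' < s} dval s') mod 2^L`. [folklore] -/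
def acc (u : Fin S.nU) : ℕ → ℕ
  | 0 => zval S y Z u
  | s + 1 => (acc u s + if h : s < S.K then dval S y u ⟨s, h⟩ else 0) % 2 ^ S.L u

/-- The final accumulator `X_u`. [folklore] -/
def xval (u : Fin S.nU) : ℕ := acc S y Z u S.K

/-- The bits of `X_u`. [folklore] -/
def xbits (u : Fin S.nU) : List Bool := List.ofFn fun i : Fin (S.L u) => (xval S y Z u).testBit i

/-- The answer to query `(u, j)`: `[cpre j ++ bits(X_u) ∈ A]`. [cite: BernsteinVazirani1997SICOMP, §8.3] -/
noncomputable def ans (A : Language Bool) (u : Fin S.nU) (j : Fin (S.L u)) : Bool :=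
  A.boolIndicator (S.cpre j ++ xbits S y Z u)

/-- **The final assignment**: controls and offsets unchanged, the answers on the answer wires,
everything else `0`. [cite: NielsenChuang2010, §3.2.5] -/
noncomputable def wFin (A : Language Bool) : BW S → Bool
  | .yreg u i => if h : (i : ℕ) < S.L u then ans S y Z A u ⟨i, h⟩ else false
  | a => w₀ S y Z a

variable {S y Z}

/-- Accumulators are below `2^L` (from step `1` on by reduction, at step `0` as a register value). [folklore] -/
theorem acc_lt (u : Fin S.nU) : ∀ s, acc S y Z u s < 2 ^ S.L u
  | 0 => regVal_lt _ _
  | _ + 1 => Nat.mod_lt _ (Nat.two_pow_pos _)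

/-! ### Semantics: the prefixes -/

/-- The list of prefix positions has no duplicates. [folklore] -/
theorem preOnes_nodup : (preOnes S).Nodup := by
  unfold preOnes
  rw [List.nodup_flatMap]
  constructor
  · intro j _
    exact ((List.nodup_finRange _).filter _).map fun p p' h => by simpa using h
  · refine (List.nodup_finRange _).pairwise_of_forall_ne fun j _ j' _ hjj => ?_
    simp only [Function.onFun, List.disjoint_left, List.mem_map, List.mem_filter]
    rintro _ ⟨p, -, rfl⟩ ⟨p', -, h⟩
    simp only [BW.pre.injEq] at h
    exact hjj h.1.symm

/-- Membership in the list of prefix positions. [folklore] -/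
theorem mem_preOnes {a : BW S} :
    a ∈ preOnes S ↔ ∃ j p, a = BW.pre j p ∧ (S.cpre j).getD (p : ℕ) false = true := by
  unfold preOnes
  simp only [List.mem_flatMap, List.mem_finRange, true_and, List.mem_map, List.mem_filter,
    decide_eq_true_eq]
  constructor
  · rintro ⟨j, p, hp, rfl⟩
    exact ⟨j, p, rfl, hp⟩
  · rintro ⟨j, p, rfl, hp⟩
    exact ⟨j, p, hp, rfl⟩

/-- **The prefixes**: `preNots` writes `cpre j` into prefix block `j` and touches nothing else. [folklore] -/
theorem clEval_preNots (w : BW S → Bool) :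
    clEval (preNots S) w = fun a => match a with
      | .pre j p => w (BW.pre j p) ^^ (S.cpre j).getD p false
      | a => w a := by
  funext a
  by_cases ha : a ∈ preOnes S
  · rw [preNots, clEval_map_not_of_mem _ preOnes_nodup _ ha]
    obtain ⟨j, p, rfl, hp⟩ := mem_preOnes.1 ha
    show (!w (BW.pre j p)) = (w (BW.pre j p) ^^ (S.cpre j).getD (p : ℕ) false)
    rw [hp, Bool.xor_true]
  · rw [preNots, clEval_map_not_of_not_mem _ _ ha]
    cases a with
    | pre j p =>
      have hp : (S.cpre j).getD (p : ℕ) false = false := by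
        by_contra h
        exact ha (mem_preOnes.2 ⟨j, p, rfl, by simpa using h⟩)
      show w (BW.pre j p) = (w (BW.pre j p) ^^ (S.cpre j).getD (p : ℕ) false)
      rw [hp, Bool.xor_false]
    | _ => rfl


/-! ### Semantics: one step -/

/-- The registers written by step `p = (u, s)`. [folklore] -/
def IsStepReg (p : Fin S.nU × Fin S.K) : BW S → Prop
  | .dreg u s _ => (u, s) = p
  | .sreg u s _ => (u, s) = p
  | .creg u s _ => (u, s) = p
  | _ => False

/-- The image of the adder placement: the accumulator wires and the low positions of the step
registers. [folklore] -/
theorem mem_range_emb_iff (u : Fin S.nU) (s : Fin S.K) (a : BW S) :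
    a ∈ Set.range (emb S u s) ↔ (∃ i : Fin (S.L u), a = accW S u s (up S i)) ∨
      (∃ i : Fin (S.L u), a = BW.dreg u s (up S i)) ∨ (∃ i : Fin (S.L u), a = BW.sreg u s (up S i)) ∨
      (∃ i : Fin (S.L u + 1), a = BW.creg u s (upc S i)) := by
  constructor
  · rintro ⟨v, rfl⟩
    cases v with
    | a i => exact Or.inl ⟨i, rfl⟩
    | b i => exact Or.inr (Or.inl ⟨i, rfl⟩)
    | s i => exact Or.inr (Or.inr (Or.inl ⟨i, rfl⟩))
    | c i => exact Or.inr (Or.inr (Or.inr ⟨i, rfl⟩))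
  · rintro (⟨i, rfl⟩ | ⟨i, rfl⟩ | ⟨i, rfl⟩ | ⟨i, rfl⟩)
    · exact ⟨AddW.a i, rfl⟩
    · exact ⟨AddW.b i, rfl⟩
    · exact ⟨AddW.s i, rfl⟩
    · exact ⟨AddW.c i, rfl⟩

/-- `accW` wires are not step registers of the same step. [folklore] -/
theorem not_isStepReg_accW (u : Fin S.nU) (s : Fin S.K) (i : Fin S.Ltop) :
    ¬ IsStepReg (u, s) (accW S u s i) := by
  unfold accW
  split_ifs with h
  · exact id
  · simp only [IsStepReg, Prod.mk.injEq, true_and]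
    intro e
    exact absurd (congrArg Fin.val e) (by simp; omega)

/-- The bits of `2^L − 2^l` (`l < L`): exactly the positions `l ≤ i < L`. [folklore] -/
theorem testBit_two_pow_sub_two_pow {L l : ℕ} (hl : l < L) (i : ℕ) :
    (2 ^ L - 2 ^ l).testBit i = (decide (l ≤ i) && decide (i < L)) := by
  have h : 2 ^ L - 2 ^ l = 2 ^ l * (2 ^ (L - l) - 1) := by
    rw [Nat.mul_sub_one, ← pow_add, Nat.add_sub_cancel' hl.le]
  rw [h, Nat.testBit_two_pow_mul, Nat.testBit_two_pow_sub_one]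
  by_cases h1 : l ≤ i
  · simp only [h1, decide_true, Bool.true_and]
    congr 1
    exact propext ⟨fun h2 => by omega, fun h2 => by omega⟩
  · simp [h1]

/-- The addend register value determined by a control bit. [cite: Kitaev1995, §3 Lemma 10] -/
def dvalOf (u : Fin S.nU) (s : Fin S.K) (b : Bool) : ℕ :=
  if S.lvl s < S.L u ∧ b = true then 2 ^ S.L u - 2 ^ S.lvl s else 0

/-- **The step lemma.** On an assignment whose step registers of `(u, s)` are clear, the step
leaves every other wire unchanged and writes into the low `L u` bits of its sum register the bits
of `(acc + y_s (2^L − 2^{lvl s})) mod 2^L`, `acc` the value read on the accumulator wires.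
[cite: VedralBarencoEkert1996, §3.1] -/
theorem clEval_stepOps (u : Fin S.nU) (s : Fin S.K) (w : BW S → Bool)
    (hfresh : ∀ a, IsStepReg (u, s) a → w a = false) :
    (∀ a, ¬ IsStepReg (u, s) a → clEval (stepOps S (u, s)) w a = w a) ∧
      ∀ i : Fin (S.L u), clEval (stepOps S (u, s)) w (BW.sreg u s (up S i)) =
        ((regVal (fun i : Fin (S.L u) => accW S u s (up S i)) w + dvalOf u s (w (BW.ctrl u s))) %
          2 ^ S.L u).testBit i := by
  -- the fan-out
  set w₁ := clEval (fanout S u s) w with hw₁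
  have hfan_of : ∀ a, (∀ i : Fin (S.L u), a ≠ BW.dreg u s (up S i)) → w₁ a = w a := by
    intro a ha
    rw [hw₁, fanout]
    split_ifs with hl
    · exact clEval_copyOps_of_ne _ _ fun q hq => by
        obtain ⟨i, -, rfl⟩ := List.mem_map.1 hq
        exact (ha i).symm
    · rfl
  have hfan_d : ∀ i : Fin (S.L u), w₁ (BW.dreg u s (up S i)) =
      (decide (S.lvl s < S.L u) && decide (S.lvl s ≤ (i : ℕ)) && w (BW.ctrl u s)) := by
    intro i
    have h0 : w (BW.dreg u s (up S i)) = false := hfresh _ rfl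
    rw [hw₁, fanout]
    split_ifs with hl
    · by_cases hi : S.lvl s ≤ (i : ℕ)
      · have hp : (BW.ctrl u s, BW.dreg u s (up S i)) ∈ fanPairs S u s :=
          List.mem_map.2 ⟨i, List.mem_filter.2 ⟨List.mem_finRange i, by simpa using hi⟩, rfl⟩
        have hnd : ((fanPairs S u s).map Prod.snd).Nodup := by
          rw [fanPairs, List.map_map]
          exact ((List.nodup_finRange _).filter _).map fun i i' h => by simpa using h
        have hdis : ∀ q ∈ fanPairs S u s, ∀ q' ∈ fanPairs S u s, q'.2 ≠ q.1 := by
          intro q hq q' hq'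
          obtain ⟨i₁, -, rfl⟩ := List.mem_map.1 hq
          obtain ⟨i₂, -, rfl⟩ := List.mem_map.1 hq'
          simp
        have := clEval_copyOps_target _ hnd hdis w hp
        simp only at this
        rw [this, h0]
        simp [hl, hi]
      · rw [clEval_copyOps_of_ne, h0]
        · simp [hi]
        · rintro q hq
          obtain ⟨i', hi', rfl⟩ := List.mem_map.1 hq
          simp only [ne_eq, BW.dreg.injEq, true_and]
          intro e
          have := (List.mem_filter.1 hi').2
          rw [Fin.castLE_inj] at e
          subst e
          exact hi (by simpa using this)
    · simp [h0, hl]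
  -- values on the adder wires before the adder
  have hs0 : ∀ j : Fin (S.L u), (w₁ ∘ emb S u s) (AddW.s j) = false := fun j => by
    show w₁ (BW.sreg u s (up S j)) = false
    rw [hfan_of _ fun i => by simp]
    exact hfresh _ rfl
  have hc0 : ∀ j : Fin (S.L u + 1), (w₁ ∘ emb S u s) (AddW.c j) = false := fun j => by
    show w₁ (BW.creg u s (upc S j)) = false
    rw [hfan_of _ fun i => by simp]
    exact hfresh _ rfl
  have hA : regVal AddW.a (w₁ ∘ emb S u s) = regVal (fun i : Fin (S.L u) => accW S u s (up S i)) w :=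
    regVal_congr fun j => hfan_of _ fun i => accW_ne_dreg u s _ _
  have hB : regVal AddW.b (w₁ ∘ emb S u s) = dvalOf u s (w (BW.ctrl u s)) := by
    refine regVal_eq_of_testBit _ _ ?_ fun j => ?_
    · unfold dvalOf
      split_ifs
      · exact Nat.sub_lt (Nat.two_pow_pos _) (Nat.two_pow_pos _)
      · exact Nat.two_pow_pos _
    · show w₁ (BW.dreg u s (up S j)) = _
      rw [hfan_d]
      unfold dvalOf
      by_cases hl : S.lvl s < S.L u
      · cases hb : w (BW.ctrl u s)
        · simp
        · rw [if_pos ⟨hl, rfl⟩, testBit_two_pow_sub_two_pow hl]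
          simp [hl, j.isLt]
      · simp [hl]
  -- the adder
  have hstep : clEval (stepOps S (u, s)) w = clEval (adder S u s) w₁ := by
    rw [stepOps, clEval_append]
  have hsum := regVal_addOps (w₁ ∘ emb S u s) hs0 (fun j _ => hc0 j)
  rw [hA, hB, hc0, Bool.toNat_false, add_zero] at hsum
  constructor
  · intro a ha
    rw [hstep, adder]
    by_cases hr : a ∈ Set.range (emb S u s)
    · rcases (mem_range_emb_iff u s a).1 hr with ⟨i, rfl⟩ | ⟨i, rfl⟩ | ⟨i, rfl⟩ | ⟨i, rfl⟩
      · rw [show accW S u s (up S i) = emb S u s (AddW.a i) from rfl,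
          clEval_map_apply (emb_injective u s), clEval_addOps _ hs0 (fun j _ => hc0 j)]
        exact hfan_of _ fun i' => accW_ne_dreg u s _ _
      · exact absurd rfl ha
      · exact absurd rfl ha
      · exact absurd rfl ha
    · rw [clEval_map_apply_of_not_mem_range _ _ _ hr]
      refine hfan_of a fun i e => hr ?_
      exact e ▸ ⟨AddW.b i, rfl⟩
  · intro i
    rw [hstep, adder, show BW.sreg u s (up S i) = emb S u s (AddW.s i) from rfl,
      clEval_map_apply (emb_injective u s),
      ← testBit_regVal AddW.s (clEval (addOps (S.L u)) (w₁ ∘ emb S u s)) i]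
    congr 1
    -- `X + c 2^L = acc + d` with `X < 2^L`
    have hX := regVal_lt AddW.s (clEval (addOps (S.L u)) (w₁ ∘ emb S u s))
    rw [← hsum, Nat.add_mul_mod_self_right, Nat.mod_eq_of_lt hX]

/-! ### Semantics: all the steps -/

/-- The assignment after the prefixes. [folklore] -/
def w₁ : BW S → Bool := clEval (preNots S) (w₀ S y Z)

/-- After the prefixes: prefix block `j` holds `cpre j`, everything else is as initially. [folklore] -/
theorem w₁_apply (a : BW S) : w₁ (y := y) (Z := Z) a = match a with
    | .pre j p => (S.cpre j).getD p false
    | a => w₀ S y Z a := by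
  unfold w₁
  rw [clEval_preNots]
  cases a with
  | pre j p => simp [w₀]
  | _ => rfl

/-- The execution index of a step. [folklore] -/
def sIdx (p : Fin S.nU × Fin S.K) : ℕ := finProdFinEquiv p

/-- **The invariant after the steps of index `< m`**: wires that are not registers of these
steps are as after the prefixes; the sum register of every executed step holds its accumulator.
[folklore] -/
def Inv (m : ℕ) (w : BW S → Bool) : Prop :=
  (∀ a, (∀ p, sIdx p < m → ¬ IsStepReg p a) → w a = w₁ (y := y) (Z := Z) a) ∧
    ∀ p : Fin S.nU × Fin S.K, sIdx p < m → ∀ i : Fin (S.L p.1),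
      w (BW.sreg p.1 p.2 (up S i)) = (acc S y Z p.1 (p.2 + 1)).testBit i

/-- Initially the invariant holds. [folklore] -/
theorem inv_zero : Inv (y := y) (Z := Z) 0 (w₁ (y := y) (Z := Z)) :=
  ⟨fun _ _ => rfl, fun _ h => absurd h (Nat.not_lt_zero _)⟩

/-- Registers of distinct steps are distinct wires. [folklore] -/
theorem isStepReg_unique {p q : Fin S.nU × Fin S.K} {a : BW S} (hp : IsStepReg p a) (hq : IsStepReg q a) :
    p = q := by
  cases a <;> first | exact hp.symm.trans hq | exact absurd hp id

/-- The step of execution index `m`. [folklore] -/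
def stepAt {m : ℕ} (hm : m < S.nU * S.K) : Fin S.nU × Fin S.K := finProdFinEquiv.symm ⟨m, hm⟩

/-- Its index is `m`. [folklore] -/
theorem sIdx_stepAt {m : ℕ} (hm : m < S.nU * S.K) : sIdx (stepAt (S := S) hm) = m := by
  simp [sIdx, stepAt, Nat.mod_add_div]

/-- **Preservation of the invariant by the next step.** [folklore] -/
theorem inv_step {m : ℕ} (hm : m < S.nU * S.K) {w : BW S → Bool} (hw : Inv (y := y) (Z := Z) m w) :
    Inv (y := y) (Z := Z) (m + 1) (clEval (stepOps S (stepAt hm)) w) := by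
  obtain ⟨hw1, hw2⟩ := hw
  set u := (stepAt (S := S) hm).1 with hu
  set s := (stepAt (S := S) hm).2 with hs
  have hp : stepAt (S := S) hm = (u, s) := rfl
  have hidx : sIdx (u, s) = m := by rw [← hp]; exact sIdx_stepAt hm
  have hidx' : (s : ℕ) + S.K * u = m := by simpa [sIdx] using hidx
  -- indices below `m + 1`: below `m`, or the new step
  have hlt : ∀ q : Fin S.nU × Fin S.K, sIdx q < m + 1 ↔ sIdx q < m ∨ q = (u, s) := by
    intro q
    constructor
    · intro h
      rcases Nat.lt_succ_iff_lt_or_eq.1 h with h | h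
      · exact Or.inl h
      · right
        have : finProdFinEquiv q = finProdFinEquiv (u, s) := Fin.ext (h.trans hidx.symm)
        exact finProdFinEquiv.injective this
    · rintro (h | rfl)
      · exact Nat.lt_succ_of_lt h
      · rw [hidx]; exact Nat.lt_succ_self m
  -- the registers of the new step are still clear
  have hfresh : ∀ a, IsStepReg (u, s) a → w a = false := by
    intro a ha
    rw [hw1 a fun q hq hqa => ?_]
    · cases a with
      | dreg _ _ _ => rw [w₁_apply]; rfl
      | sreg _ _ _ => rw [w₁_apply]; rfl
      | creg _ _ _ => rw [w₁_apply]; rfl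
      | _ => exact absurd ha id
    · have := isStepReg_unique hqa ha
      rw [this, hidx] at hq
      exact lt_irrefl _ hq
  obtain ⟨hoff, hsum⟩ := clEval_stepOps u s w hfresh
  rw [hp]
  refine ⟨fun a ha => ?_, fun q hq i => ?_⟩
  · have ha' : ¬ IsStepReg (u, s) a := ha (u, s) ((hlt _).2 (Or.inr rfl))
    rw [hoff a ha']
    exact hw1 a fun q hq => ha q ((hlt q).2 (Or.inl hq))
  · rcases (hlt q).1 hq with hq | rfl
    · -- an earlier step: its sum register is not a register of `(u, s)`
      have hne : (q.1, q.2) ≠ (u, s) := fun e => by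
        rw [show q = (u, s) from e, hidx] at hq
        exact lt_irrefl _ hq
      rw [hoff (BW.sreg q.1 q.2 (up S i)) fun h => hne h]
      exact hw2 q hq i
    · -- the new step: accumulator wires hold `acc u s`, the control holds `y u s`
      rw [hsum i]
      congr 1
      have hctrl : w (BW.ctrl u s) = y u s := by
        rw [hw1 (BW.ctrl u s) fun q _ h => h, w₁_apply]
        rfl
      have hacc : regVal (fun i : Fin (S.L u) => accW S u s (up S i)) w = acc S y Z u s := by
        by_cases hs0 : (s : ℕ) = 0
        · have hW : ∀ i : Fin (S.L u), accW S u s (up S i) = BW.zbit u (up S i) := fun i => by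
            simp [accW, hs0]
          rw [regVal_congr fun i => by rw [hW i, hw1 (BW.zbit u (up S i)) fun q _ h => h, w₁_apply], hs0]
          rfl
        · have hs1 : (s : ℕ) - 1 < S.K := by omega
          have hW : ∀ i : Fin (S.L u), accW S u s (up S i) = BW.sreg u ⟨(s : ℕ) - 1, hs1⟩ (up S i) :=
            fun i => by simp [accW, hs0]
          have hqm : sIdx (u, (⟨(s : ℕ) - 1, hs1⟩ : Fin S.K)) < m := by
            simp only [sIdx, finProdFinEquiv_apply_val]
            omega
          have hbits := hw2 (u, ⟨(s : ℕ) - 1, hs1⟩) hqm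
          simp only at hbits
          rw [show (s : ℕ) - 1 + 1 = s by omega] at hbits
          exact regVal_eq_of_testBit _ _ (acc_lt u s) fun i => by rw [hW i, hbits i]
      rw [hacc, hctrl]
      show (acc S y Z u s + dvalOf u s (y u s)) % 2 ^ S.L u = acc S y Z u (s + 1)
      simp only [acc, dif_pos s.isLt, Fin.eta]
      rfl

/-- **The invariant after the first `m` steps.** [folklore] -/
theorem inv_steps : ∀ (m : ℕ) (hm : m ≤ S.nU * S.K),
    Inv (y := y) (Z := Z) m (clEval (((steps S).take m).flatMap (stepOps S)) (w₁ (y := y) (Z := Z)))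
  | 0, _ => by simpa using inv_zero
  | m + 1, hm => by
    have hm' : m < S.nU * S.K := hm
    have hlen : m < (steps S).length := by simpa [steps] using hm'
    rw [List.take_succ_eq_append_getElem hlen, List.flatMap_append, clEval_append]
    have hget : (steps S)[m] = stepAt hm' := by
      simp [steps, stepAt]
    simp only [List.flatMap_cons, List.flatMap_nil, List.append_nil, hget]
    exact inv_step hm' (inv_steps m hm'.le)

/-- The wires never written by any step. [folklore] -/
def IsFrame (a : BW S) : Prop := ∀ p, ¬ IsStepReg p a

/-- **The compute part**: frame wires as after the prefixes, `X_u` on the last sum register.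
[cite: VedralBarencoEkert1996, §3.1] -/
theorem clEval_wOps :
    (∀ a, IsFrame a → clEval (wOps S) (w₀ S y Z) a = w₁ (y := y) (Z := Z) a) ∧
      ∀ (u : Fin S.nU) (i : Fin (S.L u)),
        clEval (wOps S) (w₀ S y Z) (BW.sreg u (lastStep S) (up S i)) = (xval S y Z u).testBit i := by
  have h := inv_steps (y := y) (Z := Z) (S.nU * S.K) le_rfl
  rw [List.take_of_length_le (by simp [steps])] at h
  have hw : clEval (wOps S) (w₀ S y Z) = clEval ((steps S).flatMap (stepOps S)) (w₁ (y := y) (Z := Z)) := by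
    rw [wOps, clEval_append]; rfl
  obtain ⟨h1, h2⟩ := h
  refine ⟨fun a ha => by rw [hw]; exact h1 a fun p _ => ha p, fun u i => ?_⟩
  rw [hw, h2 (u, lastStep S) (Fin.isLt _) i]
  show (acc S y Z u (S.K - 1 + 1)).testBit i = (xval S y Z u).testBit i
  rw [Nat.sub_add_cancel S.hK]
  rfl

/-! ### Semantics: the queries -/

section Queries

variable {ι α : Type} [DecidableEq ι] (A : Language Bool) (qs : α → List ι) (tg : α → ι)

/-- **A list of queries with pairwise distinct answer wires, none of which is a query wire**: an
answer wire receives the XOR with the oracle's answer on its query wires (read in the initial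
assignment), every other wire is unchanged (the `ℕ`-wired case is `OCoin.ocEval_oracles`).
[cite: BernsteinVazirani1997SICOMP, §8.3 (p. 1455)] -/
theorem ocEval_oracles :
    ∀ (L : List α) (_ : (L.map tg).Nodup) (_ : ∀ a ∈ L, ∀ b ∈ L, tg a ∉ qs b) (w : ι → Bool),
      (∀ a ∈ L, ocEval A (L.map fun a => RtOp.oracle (qs a) (tg a)) w (tg a) =
          (w (tg a) ^^ A.boolIndicator ((qs a).map w))) ∧
        ∀ i, (∀ a ∈ L, tg a ≠ i) → ocEval A (L.map fun a => RtOp.oracle (qs a) (tg a)) w i = w i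
  | [], _, _, w => by simp
  | a :: L, hnd, hdis, w => by
    rw [List.map_cons, List.nodup_cons] at hnd
    have hdis' : ∀ a' ∈ L, ∀ b ∈ L, tg a' ∉ qs b := fun a' ha' b hb =>
      hdis a' (List.mem_cons_of_mem _ ha') b (List.mem_cons_of_mem _ hb)
    set w' := ocAct A (RtOp.oracle (qs a) (tg a)) w with hw'
    obtain ⟨ih1, ih2⟩ := ocEval_oracles L hnd.2 hdis' w'
    have hstep : ocEval A ((a :: L).map fun a => RtOp.oracle (qs a) (tg a)) w =
        ocEval A (L.map fun a => RtOp.oracle (qs a) (tg a)) w' := by rw [List.map_cons, ocEval_cons]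
    have hw'a : w' (tg a) = (w (tg a) ^^ A.boolIndicator ((qs a).map w)) := by simp [hw', ocAct]
    have hw'ne : ∀ i, i ≠ tg a → w' i = w i := fun i hi => by simp [hw', ocAct, update_of_ne hi]
    have hread : ∀ b ∈ a :: L, (qs b).map w' = (qs b).map w := fun b hb =>
      List.map_congr_left fun j hj => hw'ne j fun e => hdis a (by simp) b hb (e ▸ hj)
    have hnota : ∀ a' ∈ L, tg a' ≠ tg a := fun a' ha' he => hnd.1 (by rw [← he]; exact List.mem_map_of_mem ha')
    refine ⟨fun b hb => ?_, fun i hi => ?_⟩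
    · rw [hstep]
      rcases List.mem_cons.1 hb with rfl | hb'
      · rw [ih2 (tg b) hnota, hw'a]
      · rw [ih1 b hb', hread b hb, hw'ne _ (hnota b hb')]
    · rw [hstep, ih2 i (fun a' ha' => hi a' (List.mem_cons_of_mem _ ha')), hw'ne i (Ne.symm (hi a (by simp)))]

end Queries

/-- The answer wires are pairwise distinct. [folklore] -/
theorem qTgt_injective : Injective (qTgt S) := by
  rintro ⟨u, j⟩ ⟨u', j'⟩ h
  simp only [qTgt, BW.yreg.injEq] at h
  obtain ⟨rfl, hj⟩ := h
  rw [Fin.castLE_inj] at hj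
  subst hj
  rfl

/-- No answer wire is a query wire. [folklore] -/
theorem qTgt_not_mem_qWires (a b : Σ u : Fin S.nU, Fin (S.L u)) : qTgt S a ∉ qWires S b := by
  simp [qTgt, qWires, preWires, xWires]

/-- **The queries**: answer wire `(u, i)`, `i < L u`, receives `[qWires (u,i) read in w ∈ A]`;
nothing else changes (answer wires initially clear). [cite: BernsteinVazirani1997SICOMP, §8.3] -/
theorem ocEval_qOps (A : Language Bool) (w : BW S → Bool) (hy : ∀ u i, w (BW.yreg u i) = false) :
    ocEval A (qOps S) w = fun a => match a with
      | .yreg u i => if h : (i : ℕ) < S.L u then A.boolIndicator ((qWires S ⟨u, ⟨i, h⟩⟩).map w) else false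
      | a => w a := by
  have hnd : ((qIdx S).map (qTgt S)).Nodup :=
    (List.Nodup.map qTgt_injective) (by
      unfold qIdx
      rw [List.nodup_flatMap]
      exact ⟨fun u _ => (List.nodup_finRange _).map (fun j j' h => by simpa using h),
        (List.nodup_finRange _).pairwise_of_forall_ne fun u _ u' _ huu => by
          simp only [Function.onFun, List.disjoint_left, List.mem_map]
          rintro _ ⟨j, -, rfl⟩ ⟨j', -, h⟩
          exact huu (congrArg Sigma.fst h).symm⟩)
  obtain ⟨h1, h2⟩ := ocEval_oracles A (qWires S) (qTgt S) (qIdx S) hnd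
    (fun a _ b _ => qTgt_not_mem_qWires a b) w
  funext a
  cases a with
  | yreg u i =>
    show ocEval A (qOps S) w (BW.yreg u i) =
      if h : (i : ℕ) < S.L u then A.boolIndicator ((qWires S ⟨u, ⟨i, h⟩⟩).map w) else false
    by_cases hi : (i : ℕ) < S.L u
    · have hmem : (⟨u, ⟨i, hi⟩⟩ : Σ u : Fin S.nU, Fin (S.L u)) ∈ qIdx S := by
        unfold qIdx
        exact List.mem_flatMap.2 ⟨u, List.mem_finRange u, List.mem_map.2 ⟨⟨i, hi⟩, List.mem_finRange _, rfl⟩⟩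
      have := h1 _ hmem
      have hq : qTgt S ⟨u, ⟨i, hi⟩⟩ = BW.yreg u i := by simp [qTgt]
      rw [hq] at this
      rw [qOps, this, hy, dif_pos hi, Bool.false_xor]
    · rw [qOps, h2 _ fun b _ e => hi ?_, hy, dif_neg hi]
      simp only [qTgt, BW.yreg.injEq] at e
      obtain ⟨rfl, rfl⟩ := e
      exact b.2.isLt
  | ctrl u s => exact h2 _ fun b _ e => by simp [qTgt] at e
  | zbit u i => exact h2 _ fun b _ e => by simp [qTgt] at e
  | pre j p => exact h2 _ fun b _ e => by simp [qTgt] at e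
  | dreg u s i => exact h2 _ fun b _ e => by simp [qTgt] at e
  | sreg u s i => exact h2 _ fun b _ e => by simp [qTgt] at e
  | creg u s i => exact h2 _ fun b _ e => by simp [qTgt] at e

/-! ### Semantics: the block -/

/-- The answer wires. [folklore] -/
def IsY : BW S → Prop
  | .yreg _ _ => True
  | _ => False

/-- Being an answer wire is decidable (by the constructor). [folklore] -/
instance instDecidablePredIsY : DecidablePred (IsY (S := S)) := fun a => by
  cases a <;> simp only [IsY] <;> infer_instance

/-- The compute part never mentions an answer wire. [folklore] -/
theorem wOps_avoid_Y : ∀ op ∈ wOps S, ¬ IsY op.target ∧ ∀ c ∈ op.controls, ¬ IsY c := by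
  intro op hop
  rw [wOps, List.mem_append] at hop
  rcases hop with hop | hop
  · obtain ⟨a, ha, rfl⟩ := List.mem_map.1 hop
    obtain ⟨j, p, rfl, -⟩ := mem_preOnes.1 ha
    exact ⟨id, fun c hc => by simp [ClOp.controls] at hc⟩
  · obtain ⟨⟨u, s⟩, -, hp⟩ := List.mem_flatMap.1 hop
    rw [stepOps, List.mem_append] at hp
    rcases hp with hp | hp
    · unfold fanout at hp
      split_ifs at hp
      · obtain ⟨q, hq, rfl⟩ := mem_copyOps.1 hp
        obtain ⟨i, -, rfl⟩ := List.mem_map.1 hq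
        exact ⟨id, fun c hc => by simp [ClOp.controls] at hc; subst hc; exact id⟩
      · simp at hp
    · obtain ⟨op', -, rfl⟩ := List.mem_map.1 hp
      have hemb : ∀ v : AddW (S.L u), ¬ IsY (emb S u s v) := by
        intro v
        cases v with
        | a i => unfold emb accW; split_ifs <;> exact id
        | _ => exact id
      refine ⟨by rw [ClOp.target_map]; exact hemb _, fun c hc => ?_⟩
      rw [ClOp.controls_map] at hc
      obtain ⟨c', -, rfl⟩ := List.mem_map.1 hc
      exact hemb c'

/-- A list read back through its own positions. [folklore] -/
theorem map_getD_finRange {β : Type} (l : List β) (d : β) {n : ℕ} (hn : n = l.length) (f : Fin n → ℕ)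
    (hf : ∀ p, f p = p) : (List.finRange n).map (fun p => l.getD (f p) d) = l := by
  subst hn
  apply List.ext_getElem (by simp)
  intro k h1 h2
  simp [hf, List.getD_eq_getElem?_getD]

/-- **The queries read the prefixes and `X_u`.** [folklore] -/
theorem map_qWires (u : Fin S.nU) (j : Fin (S.L u)) :
    (qWires S ⟨u, j⟩).map (clEval (wOps S) (w₀ S y Z)) = S.cpre j ++ xbits S y Z u := by
  obtain ⟨h1, h2⟩ := clEval_wOps (y := y) (Z := Z) (S := S)
  rw [qWires, List.map_append]
  congr 1
  · rw [preWires, List.map_map]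
    have hj : ((upj S j : Fin S.Ltop) : ℕ) = j := rfl
    refine (List.map_congr_left fun p _ => ?_).trans
      (map_getD_finRange (S.cpre j) false (by rw [hj]) (fun p => (Fin.castLE (S.hcpre (upj S j)) p : ℕ))
        fun p => rfl)
    show clEval (wOps S) (w₀ S y Z) (BW.pre (upj S j) _) = _
    rw [h1 _ fun q => id, w₁_apply]
    rfl
  · rw [xWires, List.map_map, xbits, List.ofFn_eq_map]
    exact List.map_congr_left fun i _ => h2 u i

/-- **Semantics of the block** (compute–query–uncompute): controls and offsets unchanged, the
answer bit `(u, j)` equal to `[cpre j ++ bits(X_u) ∈ A]`, every other wire back to `0`.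
[cite: NielsenChuang2010, §3.2.5] -/
theorem ocEval_blockOps (A : Language Bool) : ocEval A (blockOps S) (w₀ S y Z) = wFin S y Z A := by
  rw [blockOps, ocEval_append, ocEval_append, ocEval_map_cl, ocEval_map_cl]
  obtain ⟨hW1, -⟩ := clEval_wOps (y := y) (Z := Z) (S := S)
  have hy : ∀ u i, clEval (wOps S) (w₀ S y Z) (BW.yreg u i) = false := fun u i => by
    rw [hW1 _ fun q => id, w₁_apply]; rfl
  rw [ocEval_qOps A _ hy]
  -- the queried state as a modification of the computed state on the answer wires
  set g : BW S → Bool := fun a => match a with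
    | .yreg u i => if h : (i : ℕ) < S.L u then ans S y Z A u ⟨i, h⟩ else false
    | _ => false with hg
  have hite : (fun a => match a with
      | .yreg u i => if h : (i : ℕ) < S.L u then
          A.boolIndicator ((qWires S ⟨u, ⟨i, h⟩⟩).map (clEval (wOps S) (w₀ S y Z))) else false
      | a => clEval (wOps S) (w₀ S y Z) a) =
      fun a => if IsY a then g a else clEval (wOps S) (w₀ S y Z) a := by
    funext a
    cases a with
    | yreg u i =>
      simp only [IsY, if_true, hg]
      split_ifs with h
      · rw [map_qWires]; rfl
      · rfl
    | _ => rfl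
  rw [hite, clEval_ite (IsY (S := S)) _ (fun op hop => wOps_avoid_Y op (List.mem_reverse.1 hop)),
    clEval_reverse_clEval _ wOps_wf]
  funext a
  cases a <;> simp [IsY, hg, wFin, w₀]

end PeriodFinding

end Literature.Computability.Cryptography
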